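import Summits.HodgeConjecture.HodgeConjecture.Cruxes.BlochSeedDiscOne.SeedCheckerOneAnchor
import Summits.HodgeConjecture.HodgeConjecture.Cruxes.BlochSeedDiscOne.SeedCheckerPorteous
import Summits.HodgeConjecture.HodgeConjecture.Cruxes.BlochSeedDiscOne.SigmaH

/-!
line stmt-HodgeConjecture-18881 Cruxes/BlochSeedDiscOne/Lines/birth.lean 814a6a70c14e831a stub_rung_pad4_seedAt

# SeedCheckerSplitBlock — v41 (hsemireg-c5c8-1 g53, 2026-08-31): the checker owner's TYPING SPEC for the re-typed line
# `Lines/splitblock.lean` of director-hodge R19.832 (D4) (RUNG 2a «split-block certificate», RUNG 2b «letter shadow»)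

ADDITIVE to v1–v40 (`SeedChecker*.lean`): no declaration of the lineage is changed; imports only BUILT modules (`SeedCheckerOneAnchor` v11,
`SeedCheckerPorteous` v5 — both over `SeedChecker` v4 — and the letter-model chain `SigmaH ⟵ RuleDPlate ⟵ LeggedFloor ∕ HallB136 ⟵ … ⟵
DepthBoundA4`).  This file is NOT `Lines/splitblock.lean` (one writer: the planner seat `cruxplan-18881-splitblock` of req-191 (A)); it registers
NO stub and contains NO `sorry`.  It supplies, over existing declarations only:

§41.1 THE SIEVE ROWS of (D4) 2b as ONE predicate on a letter design `DepthBoundA4.Design`, split into the SCOPE rows (`OnAlphabet h`, `Disj` —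
      normal-form clauses of the READING-1 ansatz, json-decidable, NOT consequences of any geometry) and the SHADOW rows (`A1`, `RuleD`, `HallUp`,
      `HallPlusUp · 8`, `μ ≠ 0`, `BudgetClause σ π`); the bridge `SieveRows h σ π D' → RuleDPlate.SPlus h σ π → False` (the statement of record
      `S⁺(h)` IS «no letter design passes the sieve rows», `sPlus_iff_forall_not_sieveRows`).
§41.2 THE LETTER SHADOW `Design.shadow : SeedChecker.Design → DepthBoundA4.Design` (cells `(α, Re β, Im β) ↦ ⟨α, Re β, −Im β⟩` — the sign
      makes the two letter conventions agree: `DepthBoundA4` writes a letter's class `a·h + β̄·e + β·ē`, the 𝔅(μ₄) cell tensor `bphi` puts `β` on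
      `e`; PROVED per symbol and per cell: `coef_shadowLetter`, `cellCoef_shadowCell`), multiplicities `Int.toNat`, `Finset.toList` order
      (irrelevant to every row).
§41.3 THE C-FREE CORE of RUNG 2a at ONE anchor, `CoreCert E₀ ψ₀ := ∃ D K Z i q, D.SeedCheck K i q`, with its door to the crux BY NAME
      (`blochSeedDiscOne_of_coreCert`, v11's one-anchor door: the crux is EXISTENTIAL in the eightfold, so ONE CM anchor suffices — the
      certificate need not be `∀ (E₀, ψ₀)` like `stub_rung_pad4_seedAt`).  FLAG (costume): `CoreCert` carries NO bundle, block or section — typed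
      alone as «2a» it is the crux at one anchor in json clothing and cannot feed 2b.
§41.4 THE SPLIT-BLOCK DATUM `SplitBlockDatum C E₀ ψ₀` (a STRUCTURE = data, nothing asserts one exists): anchor kit + linked word frame; the
      SHELL design `Dsh` (json); the split two-term block `0 → 𝓟 → 𝓝 → 𝓔 → 0` with BOTH terms SPLIT into the letter line bundles of `Dsh`'s cells
      with their multiplicities (`BlockTerm`: letter kit + injections ∕ projections + the biproduct equations — the splitting 2b's geometric rows
      need, which a `CokernelPresentation` (Chern-character level) does not record); the FRAME `0 → 𝒪^k → 𝓔 → Q → 0` cutting `𝓔` (rank `4 + k`,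
      `k = r − 4 ≥ 4` under PortHall₈) down to a rank-`4` quotient `Q` (R19.625 (i)'s `π = 0` reading «rank-4-quotient zero locus»); a section `s`
      of `Q` and the presented subscheme `i : Z ↪ S⁴`.  Predicates on it: `Passes` (`(Dsh.padApexUp 0 k).SeedCheck K i q` for some `q` ∧
      `i` IS the zero scheme of `s`), `PassesLaw` (C0 of the padded design + zero scheme + C5 + C6-integral + C7, NO (σ) clause) with
      `passes_of_passesLaw` GIVEN `TopChernFourLocalisation C` (the (σ) clause DISCHARGED through `RealisesTensor.shortExact_right`,
      `Design.wch_padApexUp`, `Design.realisedBy_of_realisesTensor`, `Design.seedCheck_of_zeroScheme`).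
§41.5 RUNG 2a ∕ RUNG 2b TYPED and the two compositions the line needs: `Rung2a C h := ∃ CM anchor, ∃ δ, δ.Passes ∧ ScopeRows h δ.Dsh.shadow`;
      `blochSeedDiscOne_of_rung2a : Rung2a C h → BlochSeedDiscOne` (sorry-free; what `BlochSeedDiscOne_of` of the new skeleton can be);
      `Rung2b C σ π := ∀ CM anchor δ, δ.Passes → ShadowRows σ π δ.Dsh.shadow`; THE KILL PATH `not_rung2a_of_rung2b_of_sPlus :
      Rung2b C σ π → SPlus h σ π → ¬ Rung2a C h` and the scope-explicit variant `Rung2aRows` with `not_rung2aRows_of_sPlus` (no 2b needed when the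
      rows are carried in the certificate).  The Porteous reading (`π = 672`, `D₄(𝒪⁵ → 𝓔)`, v5 `TwoTermDatum` ∕ `PorteousFourLocalisation`) is the
      sibling datum `SplitBlockDatumP` with `passesP_door`.
§41.5′ THE SHEAF DOOR (director R19.838 amendment, memo-209 v1.1 §6): the CORE `SplitBlockCore` (kit, frame link, shell design, split block)
      is by itself the sheaf door's datum — `PassesSheaf I := Dsh.SheafSeedCheckRankFree C I K 𝓔` (𝓔 = the block's cokernel, rank free),
      `passesSheaf_of_passesSheafLaw` LAW-FREE (v3), endpoint `HasHyperbolicBFSheafSeedOn C 4 1 I` → `HasLocallyAlgebraicWeilAnchor 4 1` under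
      BF 5.1 — NOT the crux (no bridge `HasHyperbolicBFSheafSeedOn → HasHyperbolicBlochSeed` in the tree, grep 2026-08-31); `Rung2aSheaf`,
      `Rung2bSheaf`, `not_rung2aSheaf_of_rung2bSheaf_of_sPlus`.  The lci and Porteous data EXTEND the core.
§41.6 a NAMED LAW (Prop, not asserted) `LetterHomVanishing C Φ` («no non-zero map `L_P → L_N` between letter bundles unless `WeakLive`»), the
      hypothesis under which the shadow rows `HallUp` ∕ `HallPlusUp` become linear algebra + Porteous on the block (pen rows α1 ∕ α2 of R19.832 (D3)).

Nothing here is proved toward HC ∕ HC_CM ∕ HC_AV ∕ №4 ∕ 26512 ∕ 18881 ∕ H2: no datum is constructed, both laws are hypotheses, every door is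
hypothesis-carrying; this is a typed file, not a rung.  No `instance`, no notation, no `axiom`, no `sorry`, no `set_option allowUnsafeReducibility`.
-/

noncomputable section

set_option linter.dupNamespace false
set_option autoImplicit false

open CategoryTheory AlgebraicGeometry
open Literature.AlgebraicGeometry Literature.AlgebraicGeometry.Motives Literature.AlgebraicGeometry.HodgeTheory
open Literature.AlgebraicTopology.SingularHomology

namespace Summit.HodgeConjecture.HodgeConjecture.Cruxes.BlochSeedDiscOne.SeedChecker

open Summit.HodgeConjecture.HodgeConjecture.Cruxes.BlochSeedDiscOne.Anchor
open Summit.Ventures.HSemireg Summit.Ventures.HSemireg.Pad4Tower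

namespace SplitBlock

/-! ## §41.1 The sieve rows of R19.832 (D4) RUNG 2b, as predicates on a letter design; the bridge to `S⁺` -/

section SieveRows

/-- **SCOPE ROWS** (rows 2 of (D4): READING-1 normal form): every letter on the height-`h` alphabet (`a + |x| + |y| = h`, `a ≥ 0`) and
DISJOINT `N`-∕`P`-supports.  Json-decidable; an ANSATZ clause — no presentation implies it, so it belongs on the CERTIFICATE side (2a). -/
def ScopeRows (h : ℤ) (D' : DepthBoundA4.Design) : Prop :=
  D'.OnAlphabet h ∧ LeggedFloor.Disj D'

/-- **SHADOW ROWS** (rows 3–7 + budget of (D4)): (A1)-clean (tree form), RULE D (door (H2)), Hall (door 1), PortHall₈, `μ ≠ 0`, and the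
cycle-door budget `σ D' + 28·(rank − 4) + π ≤ 3136` (`3136 = 56² = h^{3,5}(S⁴)`, the target dimension of Bloch's map). -/
def ShadowRows (σ : DepthBoundA4.Design → ℤ) (π : ℤ) (D' : DepthBoundA4.Design) : Prop :=
  D'.A1 ∧ LeggedFloor.RuleD D' ∧ HallB136.HallUp D' ∧ RuleDPlate.HallPlusUp D' 8 ∧ D'.mu ≠ 0 ∧ RuleDPlate.BudgetClause σ π D'

/-- **THE SIEVE ROWS** = scope rows ∧ shadow rows: verbatim the hypothesis list of `RuleDPlate.SPlus h σ π`. -/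
def SieveRows (h : ℤ) (σ : DepthBoundA4.Design → ℤ) (π : ℤ) (D' : DepthBoundA4.Design) : Prop :=
  ScopeRows h D' ∧ ShadowRows σ π D'

/-- the rows OF RECORD: `h = 14`, `σ = Σ-H` (`SigmaH.sigmaH`), `π = 0` (the rank-4-quotient zero-locus reading, R19.625 (i)). -/
def SieveRowsOfRecord (D' : DepthBoundA4.Design) : Prop := SieveRows 14 SigmaH.sigmaH 0 D'

/-- **`S⁺(h; σ, π)` IS «no letter design passes the sieve rows».** [unfolding] -/
theorem sPlus_iff_forall_not_sieveRows (h : ℤ) (σ : DepthBoundA4.Design → ℤ) (π : ℤ) :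
    RuleDPlate.SPlus h σ π ↔ ∀ D' : DepthBoundA4.Design, ¬ SieveRows h σ π D' := by
  rw [RuleDPlate.sPlus_iff]
  constructor
  · rintro H D' ⟨⟨h1, h2⟩, h3, h4, h5, h6, h7, h8⟩
    exact H D' h1 h2 h3 h4 h5 h6 h7 h8
  · intro H D' h1 h2 h3 h4 h5 h6 h7 h8
    exact H D' ⟨⟨h1, h2⟩, h3, h4, h5, h6, h7, h8⟩

/-- a design passing the sieve rows contradicts `S⁺`. -/
theorem SieveRows.false_of_sPlus {h : ℤ} {σ : DepthBoundA4.Design → ℤ} {π : ℤ} {D' : DepthBoundA4.Design}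
    (hr : SieveRows h σ π D') (hS : RuleDPlate.SPlus h σ π) : False :=
  (sPlus_iff_forall_not_sieveRows h σ π).1 hS D' hr

/-- PortHall₈ among the shadow rows forces `8 ≤ rank` on a non-empty `P` side (`RuleDPlate.eight_le_rank_of_hallPlusUp`): the letter designs the
sieve speaks about have rank `≥ 8`, so their blocks are NOT clients of a rank-`4` door as such — a FRAME (§41.4) or `𝒪⁵` (§41.5, Porteous) cuts
the rank. -/
theorem ShadowRows.eight_le_rank {σ : DepthBoundA4.Design → ℤ} {π : ℤ} {D' : DepthBoundA4.Design} (hr : ShadowRows σ π D')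
    (hpos : 0 < (D'.P.map Prod.snd).sum) : 8 ≤ D'.rank :=
  RuleDPlate.eight_le_rank_of_hallPlusUp D' hr.2.2.2.1 hpos

end SieveRows

/-! ## §41.2 The letter shadow `SeedChecker.Design → DepthBoundA4.Design` -/

section Shadow

/-- the shadow of a balanced factor point `(α, Re β, Im β)`: the letter `⟨α, Re β, −Im β⟩` (sign: `DepthBoundA4` puts `β̄` on `e`, `bphi` puts
`β` on `e`; with the flip both give the cell the SAME class). -/
def shadowLetter (x : BPoint) : DepthBoundA4.Letter := ⟨x.1, x.2.1, -x.2.2⟩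

/-- the shadow of a 𝔅(μ₄) cell. -/
def shadowCell (Z : MCell) : DepthBoundA4.Cell := fun f => shadowLetter (Z f)

/-- **THE LETTER SHADOW OF A DESIGN**: the same cells and multiplicities, as the letter model's lists (`Finset.toList` order; multiplicities
`Int.toNat` — designs of record are `Positive`). -/
def _root_.Summit.HodgeConjecture.HodgeConjecture.Cruxes.BlochSeedDiscOne.SeedChecker.Design.shadow (D : Design) :
    DepthBoundA4.Design :=
  ⟨D.cfg.lower.toList.map fun Z => (shadowCell Z, (D.mN Z).toNat),
   D.cfg.upper.toList.map fun P => (shadowCell P, (D.mP P).toNat)⟩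

/-- the symbol dictionary `{1, h, e, ē, pt} → {1, u, v, e, ē, p}` (`h ↦ u`; `u` and `v` carry the same coefficient `α`). -/
def liftSym : DepthBoundA4.Sym → Fin 6
  | .one => 0
  | .h => 1
  | .e => 3
  | .ebar => 4
  | .pt => 5

/-- words lift factorwise. -/
def liftWord (w : DepthBoundA4.Word) : CWord := fun f => liftSym (w f)

/-- **the two letter conventions agree under the shadow**, symbol by symbol. -/
theorem coef_shadowLetter (s : DepthBoundA4.Sym) (x : BPoint) :
    DepthBoundA4.Sym.coef s (shadowLetter x) = bphi x (liftSym s) := by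
  cases s <;>
    simp [DepthBoundA4.Sym.coef, shadowLetter, liftSym, bphi, phiVec, DepthBoundA4.Letter.beta, DepthBoundA4.Letter.selfInt,
      DepthBoundA4.Letter.bnorm, Zsqrtd.ext_iff]
  -- the `pt` case is left as `re ∧ im` of `α² − (x² + (−y)²) = α² − x² − y²`
  ring_nf
  simp

/-- … hence cell by cell: `cellCoef (shadow Z) w = ch(Z)(lift w)`. -/
theorem cellCoef_shadowCell (Z : MCell) (w : DepthBoundA4.Word) :
    DepthBoundA4.cellCoef (shadowCell Z) w = Z.ch (liftWord w) := by
  simp only [DepthBoundA4.cellCoef, MCell.ch, chTensor_eq_prod, shadowCell, liftWord, coef_shadowLetter]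

end Shadow

/-! ## §41.3 The C-free core of RUNG 2a at one anchor -/

section Core

variable {E₀ : AbelianVariety ℂ} {ψ₀ : E₀ ⟶ E₀}

/-- **THE CORE CERTIFICATE on the anchor `(E₀, ψ₀)`**: a (design json, presented subscheme) pair passing the seed checker.  C-free, law-free.
FLAG: no bundle, block or section inside — alone it is the crux at one anchor in json clothing. -/
def CoreCert (E₀ : AbelianVariety ℂ) (ψ₀ : E₀ ⟶ E₀) : Prop :=
  ∃ (D : Design) (K : AnchorKit E₀ ψ₀) (Z : Scheme.{0}) (i : Z ⟶ (pad4Anchor E₀).X.left) (q : ℚ), D.SeedCheck K i q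

/-- **a core certificate on ONE CM anchor gives the crux `BlochSeedDiscOne` BY NAME** (v11 `blochSeedDiscOne_of_seedCheck_one`). -/
theorem blochSeedDiscOne_of_coreCert (hE : E₀.dim = 1) (hψ : ψ₀ ≫ ψ₀ = -(1 • 𝟙 E₀)) (h : CoreCert E₀ ψ₀) :
    Summit.HodgeConjecture.HodgeConjecture.Theses.EightfoldBlochSeeds.BlochSeedDiscOne := by
  obtain ⟨D, K, Z, i, q, hc⟩ := h
  exact blochSeedDiscOne_of_seedCheck_one hE hψ hc

end Core

/-! ## §41.4 The split-block datum (zero-scheme reading, `π = 0`): block + splittings + frame + section -/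

section Datum

variable {E₀ : AbelianVariety ℂ} {ψ₀ : E₀ ⟶ E₀} {C : ChernCharacterBetti} {Φ : WordFrame E₀}

/-- **A SPLIT TERM**: the module `𝓝` SPLIT as the direct sum `⊕_{Z ∈ s} L_Z^{⊕ m_Z}` of the letter line bundles of a letter kit on the cells `s`
with multiplicities `m` — recorded without any biproduct API as injections ∕ projections indexed by (cell, copy) with the biproduct equations —
together with the Chern-character bookkeeping the class side reads (`HasChOfLetters`, a CONSEQUENCE of the splitting by additivity; kept as a
field so that nothing here needs proving).  This is the datum 2b's geometric rows need: a `CokernelPresentation` records `[𝓝]`, not the summands. -/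
structure BlockTerm (C : ChernCharacterBetti) (Φ : WordFrame E₀) (s : Finset MCell) (m : MCell → ℤ)
    (𝓝 : (pad4Anchor E₀).X.left.Modules) where
  /-- the letter line bundles on the cells of `s` (O-cells) -/
  kit : LetterKit C Φ s
  /-- the `c`-th copy of `L_Z` into `𝓝` -/
  inj : ∀ Z : ↥s, Fin (m Z).toNat → (kit.L Z ⟶ 𝓝)
  /-- the projection of `𝓝` onto the `c`-th copy of `L_Z` -/
  proj : ∀ Z : ↥s, Fin (m Z).toNat → (𝓝 ⟶ kit.L Z)
  proj_inj_self : ∀ (Z : ↥s) (c : Fin (m Z).toNat), inj Z c ≫ proj Z c = 𝟙 (kit.L Z)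
  proj_inj_ne : ∀ (Z : ↥s) (c : Fin (m Z).toNat) (Z' : ↥s) (c' : Fin (m Z').toNat),
    (⟨Z, c⟩ : Σ Z : ↥s, Fin (m Z).toNat) ≠ ⟨Z', c'⟩ → inj Z c ≫ proj Z' c' = 0
  total : ∑ Z : ↥s, ∑ c : Fin (m Z).toNat, proj Z c ≫ inj Z c = 𝟙 𝓝
  /-- `ch(𝓝) = Σ m_Z ch(L_Z)` -/
  hasCh : HasChOfLetters C 𝓝 s m kit.L

/-- **THE SPLIT-BLOCK CORE on the anchor `(E₀, ψ₀)`** — what ALL THREE doors read: the anchor kit + a linked word frame; the SHELL design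
`Dsh` (json); the block `S = (0 → 𝓟 → 𝓝 → 𝓔 → 0)` with BOTH terms split into the letter line bundles of `Dsh`'s cells.  By itself it is the
datum of the SHEAF door (director R19.838: the letter model's rows are sheaf-door rows): its cokernel `𝓔 = S.X₃` IS the candidate sheaf seed.
DATA — nothing asserts that one exists. -/
structure SplitBlockCore (C : ChernCharacterBetti) (E₀ : AbelianVariety ℂ) (ψ₀ : E₀ ⟶ E₀) where
  /-- (pad4)(ii)–(iv): the anchor kit -/
  K : AnchorKit E₀ ψ₀
  /-- O-WF: a word frame linked to `(h_std, r₁, r₂)` -/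
  Φ : WordFrame E₀
  links : Φ.LinksTo K.F (hStd E₀ K.η)
  /-- the SHELL design (json): its cells and multiplicities are the block's letters -/
  Dsh : Design
  /-- the block `0 → 𝓟 → 𝓝 → 𝓔 → 0` -/
  S : ShortComplex (pad4Anchor E₀).X.left.Modules
  shortExact : S.ShortExact
  isVectorBundle₁ : IsVectorBundle S.X₁
  isVectorBundle₃ : IsVectorBundle S.X₃
  /-- `𝓟 = ⊕_P L_P^{m_P}` -/
  termP : BlockTerm C Φ Dsh.cfg.upper Dsh.mP S.X₁
  /-- `𝓝 = ⊕_N L_N^{m_N}` -/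
  termN : BlockTerm C Φ Dsh.cfg.lower Dsh.mN S.X₂

namespace SplitBlockCore

variable (δ : SplitBlockCore C E₀ ψ₀)

/-- the word kit `(K, Φ, links)` (v3 `WordKit`). -/
def wordKit : WordKit E₀ ψ₀ := ⟨δ.K, δ.Φ, δ.links⟩

/-- the block IS a cokernel presentation of the shell design (Chern-character level; v3 `CokernelPresentation.ofLetters`). -/
def pres : CokernelPresentation C δ.Φ δ.Dsh δ.S.X₃ :=
  CokernelPresentation.ofLetters δ.shortExact (Iso.refl _) δ.isVectorBundle₁ δ.isVectorBundle₃ δ.termP.kit δ.termN.kit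
    δ.termP.hasCh δ.termN.hasCh

/-- the `(P, c) → (N, c')` MATRIX ENTRY `L_P → L_N` of the block map (what RULE D ∕ Hall read the zero pattern of). -/
def entry (P : ↥δ.Dsh.cfg.upper) (c : Fin (δ.Dsh.mP P).toNat) (N : ↥δ.Dsh.cfg.lower) (c' : Fin (δ.Dsh.mN N).toNat) :
    δ.termP.kit.L P ⟶ δ.termN.kit.L N :=
  δ.termP.inj P c ≫ δ.S.f ≫ δ.termN.proj N c'

/-! #### the SHEAF door on the core (H2; v3 rank-free sheaf-seed checker): the cokernel `𝓔` is the seed -/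

/-- **THE CORE PASSES THE SHEAF DOOR in the window `I`**: the shell design and the block's cokernel pass the rank-free sheaf-seed checker
(`C0′ = Clean ∧ μ ≠ 0`, `4 ∈ I ⊆ {0..8}`, finite locally free, `I`-semiregular (Buchweitz–Flenner), `RealisedBy`).  The shell design is read
AS IS (rank `≥ 8` allowed: rank-free door) — no frame, no section, no subscheme. -/
def PassesSheaf (I : Finset ℕ) : Prop := δ.Dsh.SheafSeedCheckRankFree C I δ.K δ.S.X₃

/-- … law-carrying form: C0′ (json) ∧ window clauses ∧ `I`-semiregularity of `𝓔` (C7-sheaf) — `RealisedBy` ((A1@Z)) is DISCHARGED by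
exactness and needs NO localisation law (v3 `Design.sheafSeedCheckRankFree_of_cokernelPresentation`). -/
def PassesSheafLaw (I : Finset ℕ) : Prop :=
  δ.Dsh.ClassDataRankFree ∧ 4 ∈ I ∧ (∀ p ∈ I, p ≤ 8) ∧ IsISemiregular δ.isVectorBundle₃.isFiniteLocallyFree {q' | q' + 1 ∈ I}

/-- **`PassesSheafLaw ⟹ PassesSheaf`, LAW-FREE.** -/
theorem passesSheaf_of_passesSheafLaw {I : Finset ℕ} (h : δ.PassesSheafLaw I) : δ.PassesSheaf I := by
  obtain ⟨hC0, h4, hI, hsr⟩ := h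
  exact δ.Dsh.sheafSeedCheckRankFree_of_cokernelPresentation δ.wordKit δ.pres hC0 h4 hI _ hsr

/-- **a core passing the sheaf door gives the tree's one-model sheaf seed `HasHyperbolicBFSheafSeedOn C 4 1 I`** (v2
`hasHyperbolicBFSheafSeedOn_of_sheafSeedCheckRankFree`) — NOT the crux `BlochSeedDiscOne`: the tree has NO bridge
`HasHyperbolicBFSheafSeedOn → HasHyperbolicBlochSeed` (grep 2026-08-31); the sheaf seed feeds `HasLocallyAlgebraicWeilAnchor 4 1` under BF Thm. 5.1
(model rendering), `hasLocallyAlgebraicWeilAnchor_of_passesSheaf`. -/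
theorem PassesSheaf.hasHyperbolicBFSheafSeedOn (hE : E₀.dim = 1) (hψ : ψ₀ ≫ ψ₀ = -(1 • 𝟙 E₀)) {I : Finset ℕ}
    (h : δ.PassesSheaf I) : HasHyperbolicBFSheafSeedOn C 4 1 I :=
  hasHyperbolicBFSheafSeedOn_of_sheafSeedCheckRankFree hE hψ h

theorem hasLocallyAlgebraicWeilAnchor_of_passesSheaf (hE : E₀.dim = 1) (hψ : ψ₀ ≫ ψ₀ = -(1 • 𝟙 E₀)) {I : Finset ℕ}
    (hBF : BuchweitzFlenner2003_variationalHodge_ISemiregular_model) (h : δ.PassesSheaf I) : HasLocallyAlgebraicWeilAnchor 4 1 :=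
  hasLocallyAlgebraicWeilAnchor_of_BFmodel_of_hyperbolicBFSheafSeedOn hBF (PassesSheaf.hasHyperbolicBFSheafSeedOn δ hE hψ h)

end SplitBlockCore

/-- **THE SPLIT-BLOCK CORE, KERNEL ORIENTATION** `0 → 𝓔 → 𝓝 → 𝓟 → 0` (memo-209 v1.1 §6 and R19.838's row-α1 wording; v3 `KernelPresentation`):
the same letters, `𝓔 = S.X₁` the KERNEL of a fibrewise surjective `⊕N → ⊕P` (the cokernel orientation above has `𝓔 = coker (⊕P → ⊕N)`,
fibrewise injective).  The K-class `[𝓝] − [𝓟]` and the numerical Hall row are the same in both; which orientation the letter model's `WeakLive`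
encodes (`Hom(L_P, L_N)` vs `Hom(L_N, L_P)`) is pen row α1's call (R19.832 (D3)), so both are typed.  Sheaf door only here (the lci ∕ Porteous
data over this orientation differ from §41.4's by `mid : S.X₁ ≅ …` alone). -/
structure SplitBlockCoreK (C : ChernCharacterBetti) (E₀ : AbelianVariety ℂ) (ψ₀ : E₀ ⟶ E₀) where
  K : AnchorKit E₀ ψ₀
  Φ : WordFrame E₀
  links : Φ.LinksTo K.F (hStd E₀ K.η)
  Dsh : Design
  /-- the block `0 → 𝓔 → 𝓝 → 𝓟 → 0` -/
  S : ShortComplex (pad4Anchor E₀).X.left.Modules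
  shortExact : S.ShortExact
  isVectorBundle₁ : IsVectorBundle S.X₁
  isVectorBundle₃ : IsVectorBundle S.X₃
  /-- `𝓝 = ⊕_N L_N^{m_N}` (middle) -/
  termN : BlockTerm C Φ Dsh.cfg.lower Dsh.mN S.X₂
  /-- `𝓟 = ⊕_P L_P^{m_P}` (right) -/
  termP : BlockTerm C Φ Dsh.cfg.upper Dsh.mP S.X₃

namespace SplitBlockCoreK

variable (δ : SplitBlockCoreK C E₀ ψ₀)

def wordKit : WordKit E₀ ψ₀ := ⟨δ.K, δ.Φ, δ.links⟩

/-- the block IS a kernel presentation of the shell design (v3 `KernelPresentation.ofLetters`). -/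
def pres : KernelPresentation C δ.Φ δ.Dsh δ.S.X₁ :=
  KernelPresentation.ofLetters δ.shortExact (Iso.refl _) δ.isVectorBundle₁ δ.isVectorBundle₃ δ.termN.kit δ.termP.kit
    δ.termN.hasCh δ.termP.hasCh

/-- the `(N, c) → (P, c')` matrix entry `L_N → L_P` of the block map. -/
def entry (N : ↥δ.Dsh.cfg.lower) (c : Fin (δ.Dsh.mN N).toNat) (P : ↥δ.Dsh.cfg.upper) (c' : Fin (δ.Dsh.mP P).toNat) :
    δ.termN.kit.L N ⟶ δ.termP.kit.L P :=
  δ.termN.inj N c ≫ δ.S.g ≫ δ.termP.proj P c'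

/-- the core passes the sheaf door in the window `I` (the KERNEL `𝓔 = S.X₁` is the seed). -/
def PassesSheaf (I : Finset ℕ) : Prop := δ.Dsh.SheafSeedCheckRankFree C I δ.K δ.S.X₁

def PassesSheafLaw (I : Finset ℕ) : Prop :=
  δ.Dsh.ClassDataRankFree ∧ 4 ∈ I ∧ (∀ p ∈ I, p ≤ 8) ∧ IsISemiregular δ.isVectorBundle₁.isFiniteLocallyFree {q' | q' + 1 ∈ I}

/-- LAW-FREE (v3 `Design.sheafSeedCheckRankFree_of_kernelPresentation`). -/
theorem passesSheaf_of_passesSheafLaw {I : Finset ℕ} (h : δ.PassesSheafLaw I) : δ.PassesSheaf I := by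
  obtain ⟨hC0, h4, hI, hsr⟩ := h
  exact δ.Dsh.sheafSeedCheckRankFree_of_kernelPresentation δ.wordKit δ.pres hC0 h4 hI _ hsr

theorem PassesSheaf.hasHyperbolicBFSheafSeedOn (hE : E₀.dim = 1) (hψ : ψ₀ ≫ ψ₀ = -(1 • 𝟙 E₀)) {I : Finset ℕ}
    (h : δ.PassesSheaf I) : HasHyperbolicBFSheafSeedOn C 4 1 I :=
  hasHyperbolicBFSheafSeedOn_of_sheafSeedCheckRankFree hE hψ h

theorem hasLocallyAlgebraicWeilAnchor_of_passesSheaf (hE : E₀.dim = 1) (hψ : ψ₀ ≫ ψ₀ = -(1 • 𝟙 E₀)) {I : Finset ℕ}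
    (hBF : BuchweitzFlenner2003_variationalHodge_ISemiregular_model) (h : δ.PassesSheaf I) : HasLocallyAlgebraicWeilAnchor 4 1 :=
  hasLocallyAlgebraicWeilAnchor_of_BFmodel_of_hyperbolicBFSheafSeedOn hBF (PassesSheaf.hasHyperbolicBFSheafSeedOn δ hE hψ h)

end SplitBlockCoreK

/-- **THE SPLIT-BLOCK DATUM, zero-scheme reading (`π = 0`, lci door)**: the core + the frame `S' = (0 → 𝒪^k → 𝓔 → Q → 0)` with `Q` of
rank `4`; a section of `Q`; the presented subscheme.  DATA — nothing asserts that one exists. -/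
structure SplitBlockDatum (C : ChernCharacterBetti) (E₀ : AbelianVariety ℂ) (ψ₀ : E₀ ⟶ E₀) extends SplitBlockCore C E₀ ψ₀ where
  /-- the frame size `k = rank 𝓔 − 4` -/
  k : ℕ
  /-- the frame `0 → 𝒪^k → 𝓔 → Q → 0` -/
  S' : ShortComplex (pad4Anchor E₀).X.left.Modules
  shortExact' : S'.ShortExact
  /-- its middle term is the block's cokernel -/
  mid : S.X₃ ≅ S'.X₂
  /-- its left term is free of rank `k` … -/
  frameIso : S'.X₁ ≅ SheafOfModules.free (R := (pad4Anchor E₀).X.left.ringCatSheaf) (Fin k)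
  isVectorBundle₁' : IsVectorBundle S'.X₁
  /-- … and realises `k` copies of the trivial cell (`ch(𝒪^k) = k`) -/
  realisesFrame : RealisesTensor C Φ S'.X₁ ((k : ℤ) • (apexCell 0).ch)
  /-- the quotient `Q` has constant rank `4` (C5, bundle half) -/
  rank4 : HasRank S'.X₃ 4
  /-- the section of `Q` whose zero scheme is the seed -/
  s : Modules.unitModule (pad4Anchor E₀).X.left ⟶ S'.X₃
  /-- the presented subscheme -/
  Z : Scheme.{0}
  i : Z ⟶ (pad4Anchor E₀).X.left

namespace SplitBlockDatum

variable (δ : SplitBlockDatum C E₀ ψ₀)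

/-- the rank-`4` CLASS design the checker reads: the shell design with `k` trivial apex `P`-cells more (`Design.padApexUp 0 k`: `T ↦ T − k·ch(𝒪)`,
`μ`, cleanliness unchanged, rank `↦ rank − k`). -/
def classDesign : Design := δ.Dsh.padApexUp 0 δ.k

/-- **THE DATUM PASSES** (law-free form): the class design passes the SEED CHECKER on the presented subscheme for some coefficient `q`, and the
presented subscheme IS the zero scheme of the section.  (`SeedCheck` = C0 ∧ closed immersion ∧ C5 ∧ C6 ∧ C7 ∧ (σ); C-free.) -/
def Passes : Prop :=
  (∃ q : ℚ, δ.classDesign.SeedCheck δ.K δ.i q) ∧ IsZeroSchemeOf δ.s δ.i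

/-- **THE DATUM PASSES, law-carrying form**: C0 of the class design (json-decidable), the zero scheme, C5, C6 (integral; the codimension clause is
a theorem, v11 `codimOfRegularImmersion`), C7 — and NO (σ) clause: the top-Chern-class law supplies it (`passes_of_passesLaw`). -/
def PassesLaw : Prop :=
  δ.classDesign.ClassData ∧ IsZeroSchemeOf δ.s δ.i ∧ IsRegularImmersionOfCodim δ.i 4 ∧ AlgebraicGeometry.IsIntegral δ.Z ∧
    IsBlochSemiregular δ.i (2 * 4) 4

/-- the quotient `Q` realises the class design's tensor `T(Dsh) − k·ch(𝒪)` (exactness twice: the block, then the frame). -/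
theorem realisesTensor_quotient : RealisesTensor C δ.Φ δ.S'.X₃ δ.classDesign.wch := by
  rw [classDesign, Design.wch_padApexUp]
  exact RealisesTensor.shortExact_right δ.shortExact' δ.isVectorBundle₁' (isVectorBundle_of_hasRank δ.rank4) δ.realisesFrame
    (δ.pres.realisesTensor.congr_iso δ.mid)

/-- hence (A1@Z) of `Q` with the class design's `μ` in the Koszul window, once the class design is clean. -/
theorem cleanAtSeed_quotient (hcl : δ.classDesign.Clean) :
    CleanAtSeed C koszulWindow δ.K.F (hStd E₀ δ.K.η) δ.S'.X₃ δ.classDesign.mu :=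
  cleanAtSeed_of_realisedBy le_eight_of_mem_koszulWindow
    (Design.realisedBy_of_realisesTensor δ.links hcl δ.realisesTensor_quotient)

/-- **GIVEN THE LAW, `PassesLaw ⟹ Passes`**: the (σ) clause of the seed checker is DISCHARGED for the split-block-with-frame ansatz
(v4 `Design.seedCheck_of_zeroScheme`). -/
theorem passes_of_passesLaw (hE : E₀.dim = 1) (hψ : ψ₀ ≫ ψ₀ = -(1 • 𝟙 E₀)) (hloc : TopChernFourLocalisation C) (h : δ.PassesLaw) :
    δ.Passes := by
  obtain ⟨hC0, hZ, hreg, hint, hsr⟩ := h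
  obtain ⟨q, hq⟩ := δ.classDesign.seedCheck_of_zeroScheme hE hψ hC0 δ.K hloc δ.rank4 (δ.cleanAtSeed_quotient hC0.1)
    one_two_three_mem_koszulWindow.1 one_two_three_mem_koszulWindow.2.1 one_two_three_mem_koszulWindow.2.2 δ.s hZ hreg hint
    (codimOfRegularImmersion δ.i 4 hreg) hsr
  exact ⟨⟨q, hq⟩, hZ⟩

/-- a passing datum gives the core certificate on its anchor … -/
theorem Passes.coreCert (h : δ.Passes) : CoreCert E₀ ψ₀ := by
  obtain ⟨⟨q, hq⟩, _⟩ := h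
  exact ⟨δ.classDesign, δ.K, δ.Z, δ.i, q, hq⟩

/-- … hence, on a CM anchor, the crux BY NAME. -/
theorem Passes.blochSeedDiscOne (hE : E₀.dim = 1) (hψ : ψ₀ ≫ ψ₀ = -(1 • 𝟙 E₀)) (h : δ.Passes) :
    Summit.HodgeConjecture.HodgeConjecture.Theses.EightfoldBlochSeeds.BlochSeedDiscOne :=
  blochSeedDiscOne_of_coreCert hE hψ (Passes.coreCert δ h)

end SplitBlockDatum

end Datum

/-! ## §41.5 RUNG 2a and RUNG 2b typed; the line's two compositions -/

section Rungs

variable {C : ChernCharacterBetti}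

/-- **RUNG 2a (split-block certificate), typed**: on SOME CM anchor `(E₀, ψ₀)` (`dim E₀ = 1`, `ψ₀² = −1`) a split-block datum PASSES and its
shell design is in READING-1 normal form on the height-`h` alphabet (scope rows: json-decidable).  Through the Chern character theory `C`
(a hypothesis structure, D-0014; see the memo on how to quantify it in a stub). -/
def Rung2a (C : ChernCharacterBetti) (h : ℤ) : Prop :=
  ∃ (E₀ : AbelianVariety ℂ) (ψ₀ : E₀ ⟶ E₀) (_ : E₀.dim = 1) (_ : ψ₀ ≫ ψ₀ = -(1 • 𝟙 E₀)) (δ : SplitBlockDatum C E₀ ψ₀),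
    δ.Passes ∧ ScopeRows h δ.Dsh.shadow

/-- **RUNG 2a ⟹ THE CRUX `BlochSeedDiscOne` BY NAME** (sorry-free; the composition `BlochSeedDiscOne_of` of a skeleton whose only on-path stub
is 2a). -/
theorem blochSeedDiscOne_of_rung2a {h : ℤ} (h2a : Rung2a C h) :
    Summit.HodgeConjecture.HodgeConjecture.Theses.EightfoldBlochSeeds.BlochSeedDiscOne := by
  obtain ⟨E₀, ψ₀, hE, hψ, δ, hδ, _⟩ := h2a
  exact SplitBlockDatum.Passes.blochSeedDiscOne δ hE hψ hδ

/-- **RUNG 2b (letter shadow), typed**: on every CM anchor, every PASSING split-block datum has a shell design whose letter shadow passes the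
SHADOW rows (`A1`, `RuleD`, `HallUp`, `HallPlusUp · 8`, `μ ≠ 0`, budget).  A kill-path statement: not consumed by `blochSeedDiscOne_of_rung2a`. -/
def Rung2b (C : ChernCharacterBetti) (σ : DepthBoundA4.Design → ℤ) (π : ℤ) : Prop :=
  ∀ (E₀ : AbelianVariety ℂ) (ψ₀ : E₀ ⟶ E₀), E₀.dim = 1 → ψ₀ ≫ ψ₀ = -(1 • 𝟙 E₀) →
    ∀ δ : SplitBlockDatum C E₀ ψ₀, δ.Passes → ShadowRows σ π δ.Dsh.shadow

/-- **THE KILL PATH**: letter shadow ∧ `S⁺(h; σ, π)` ⟹ ¬ RUNG 2a — a closed shell sieve retires the split-block ansatz (at that height,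
functional and rider), not the crux. -/
theorem not_rung2a_of_rung2b_of_sPlus {h : ℤ} {σ : DepthBoundA4.Design → ℤ} {π : ℤ} (h2b : Rung2b C σ π)
    (hS : RuleDPlate.SPlus h σ π) : ¬ Rung2a C h := by
  rintro ⟨E₀, ψ₀, hE, hψ, δ, hδ, hscope⟩
  exact SieveRows.false_of_sPlus ⟨hscope, h2b E₀ ψ₀ hE hψ δ hδ⟩ hS

/-- **RUNG 2a WITH THE ROWS CARRIED** (scope-explicit variant): the certificate itself records that the shell design's shadow passes ALL sieve
rows.  Then `S⁺` kills it with no 2b (`not_rung2aRows_of_sPlus`), and 2b is exactly what upgrades `Rung2a` to it (`rung2aRows_of_rung2a`). -/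
def Rung2aRows (C : ChernCharacterBetti) (h : ℤ) (σ : DepthBoundA4.Design → ℤ) (π : ℤ) : Prop :=
  ∃ (E₀ : AbelianVariety ℂ) (ψ₀ : E₀ ⟶ E₀) (_ : E₀.dim = 1) (_ : ψ₀ ≫ ψ₀ = -(1 • 𝟙 E₀)) (δ : SplitBlockDatum C E₀ ψ₀),
    δ.Passes ∧ SieveRows h σ π δ.Dsh.shadow

theorem Rung2aRows.rung2a {h : ℤ} {σ : DepthBoundA4.Design → ℤ} {π : ℤ} (h2 : Rung2aRows C h σ π) : Rung2a C h := by
  obtain ⟨E₀, ψ₀, hE, hψ, δ, hδ, hrows⟩ := h2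
  exact ⟨E₀, ψ₀, hE, hψ, δ, hδ, hrows.1⟩

theorem rung2aRows_of_rung2a {h : ℤ} {σ : DepthBoundA4.Design → ℤ} {π : ℤ} (h2b : Rung2b C σ π) (h2a : Rung2a C h) :
    Rung2aRows C h σ π := by
  obtain ⟨E₀, ψ₀, hE, hψ, δ, hδ, hscope⟩ := h2a
  exact ⟨E₀, ψ₀, hE, hψ, δ, hδ, hscope, h2b E₀ ψ₀ hE hψ δ hδ⟩

theorem not_rung2aRows_of_sPlus {h : ℤ} {σ : DepthBoundA4.Design → ℤ} {π : ℤ} (hS : RuleDPlate.SPlus h σ π) :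
    ¬ Rung2aRows C h σ π := by
  rintro ⟨E₀, ψ₀, -, -, δ, -, hrows⟩
  exact hrows.false_of_sPlus hS

/-- **RUNG 2a, law-carrying form**: `PassesLaw` instead of `Passes`; GIVEN `TopChernFourLocalisation C` it implies `Rung2a`. -/
def Rung2aLaw (C : ChernCharacterBetti) (h : ℤ) : Prop :=
  ∃ (E₀ : AbelianVariety ℂ) (ψ₀ : E₀ ⟶ E₀) (_ : E₀.dim = 1) (_ : ψ₀ ≫ ψ₀ = -(1 • 𝟙 E₀)) (δ : SplitBlockDatum C E₀ ψ₀),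
    δ.PassesLaw ∧ ScopeRows h δ.Dsh.shadow

theorem rung2a_of_rung2aLaw {h : ℤ} (hloc : TopChernFourLocalisation C) (h2 : Rung2aLaw C h) : Rung2a C h := by
  obtain ⟨E₀, ψ₀, hE, hψ, δ, hδ, hscope⟩ := h2
  exact ⟨E₀, ψ₀, hE, hψ, δ, δ.passes_of_passesLaw hE hψ hloc hδ, hscope⟩

/-! ### RUNG 2a ∕ 2b in the SHEAF door (director R19.838 amendment; memo-209 v1.1 §6 «two doors»): endpoint
`HasHyperbolicBFSheafSeedOn C 4 1 I`, NOT the crux -/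

/-- **RUNG 2a, SHEAF door**: on SOME CM anchor a split-block CORE passes the rank-free sheaf-seed checker in the window `I` and its shell
design is in READING-1 normal form.  FLAG (BC6): composes to `HasHyperbolicBFSheafSeedOn C 4 1 I` and, under BF Thm. 5.1 (model rendering), to
`HasLocallyAlgebraicWeilAnchor 4 1` — NOT to `BlochSeedDiscOne` (no bridge in the tree): in a skeleton concluding the crux it is CARD CONTEXT, not
a registered stub, unless the line is re-targeted. -/
def Rung2aSheaf (C : ChernCharacterBetti) (I : Finset ℕ) (h : ℤ) : Prop :=
  ∃ (E₀ : AbelianVariety ℂ) (ψ₀ : E₀ ⟶ E₀) (_ : E₀.dim = 1) (_ : ψ₀ ≫ ψ₀ = -(1 • 𝟙 E₀)) (δ : SplitBlockCore C E₀ ψ₀),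
    δ.PassesSheaf I ∧ ScopeRows h δ.Dsh.shadow

theorem hasHyperbolicBFSheafSeedOn_of_rung2aSheaf {I : Finset ℕ} {h : ℤ} (h2a : Rung2aSheaf C I h) :
    HasHyperbolicBFSheafSeedOn C 4 1 I := by
  obtain ⟨E₀, ψ₀, hE, hψ, δ, hδ, _⟩ := h2a
  exact SplitBlockCore.PassesSheaf.hasHyperbolicBFSheafSeedOn δ hE hψ hδ

theorem hasLocallyAlgebraicWeilAnchor_of_rung2aSheaf {I : Finset ℕ} {h : ℤ}
    (hBF : BuchweitzFlenner2003_variationalHodge_ISemiregular_model) (h2a : Rung2aSheaf C I h) :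
    HasLocallyAlgebraicWeilAnchor 4 1 := by
  obtain ⟨E₀, ψ₀, hE, hψ, δ, hδ, _⟩ := h2a
  exact δ.hasLocallyAlgebraicWeilAnchor_of_passesSheaf hE hψ hBF hδ

/-- **RUNG 2b, SHEAF door**: every core passing the sheaf-seed checker has a shell design whose shadow passes the shadow rows — the reading in
which the letter model's rows (`ext² = 28·M`, `3136`, PortHall₈, RULE D) were derived (director R19.838). -/
def Rung2bSheaf (C : ChernCharacterBetti) (I : Finset ℕ) (σ : DepthBoundA4.Design → ℤ) (π : ℤ) : Prop :=
  ∀ (E₀ : AbelianVariety ℂ) (ψ₀ : E₀ ⟶ E₀), E₀.dim = 1 → ψ₀ ≫ ψ₀ = -(1 • 𝟙 E₀) →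
    ∀ δ : SplitBlockCore C E₀ ψ₀, δ.PassesSheaf I → ShadowRows σ π δ.Dsh.shadow

theorem not_rung2aSheaf_of_rung2bSheaf_of_sPlus {I : Finset ℕ} {h : ℤ} {σ : DepthBoundA4.Design → ℤ} {π : ℤ}
    (h2b : Rung2bSheaf C I σ π) (hS : RuleDPlate.SPlus h σ π) : ¬ Rung2aSheaf C I h := by
  rintro ⟨E₀, ψ₀, hE, hψ, δ, hδ, hscope⟩
  exact SieveRows.false_of_sPlus ⟨hscope, h2b E₀ ψ₀ hE hψ δ hδ⟩ hS

/-- law-carrying sheaf rung and its LAW-FREE upgrade (nothing to localise: exactness discharges (A1@Z)). -/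
def Rung2aSheafLaw (C : ChernCharacterBetti) (I : Finset ℕ) (h : ℤ) : Prop :=
  ∃ (E₀ : AbelianVariety ℂ) (ψ₀ : E₀ ⟶ E₀) (_ : E₀.dim = 1) (_ : ψ₀ ≫ ψ₀ = -(1 • 𝟙 E₀)) (δ : SplitBlockCore C E₀ ψ₀),
    δ.PassesSheafLaw I ∧ ScopeRows h δ.Dsh.shadow

theorem rung2aSheaf_of_rung2aSheafLaw {I : Finset ℕ} {h : ℤ} (h2 : Rung2aSheafLaw C I h) : Rung2aSheaf C I h := by
  obtain ⟨E₀, ψ₀, hE, hψ, δ, hδ, hscope⟩ := h2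
  exact ⟨E₀, ψ₀, hE, hψ, δ, δ.passesSheaf_of_passesSheafLaw hδ, hscope⟩

/-- the sheaf rungs in the KERNEL orientation, verbatim. -/
def Rung2aSheafK (C : ChernCharacterBetti) (I : Finset ℕ) (h : ℤ) : Prop :=
  ∃ (E₀ : AbelianVariety ℂ) (ψ₀ : E₀ ⟶ E₀) (_ : E₀.dim = 1) (_ : ψ₀ ≫ ψ₀ = -(1 • 𝟙 E₀)) (δ : SplitBlockCoreK C E₀ ψ₀),
    δ.PassesSheaf I ∧ ScopeRows h δ.Dsh.shadow

theorem hasHyperbolicBFSheafSeedOn_of_rung2aSheafK {I : Finset ℕ} {h : ℤ} (h2a : Rung2aSheafK C I h) :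
    HasHyperbolicBFSheafSeedOn C 4 1 I := by
  obtain ⟨E₀, ψ₀, hE, hψ, δ, hδ, _⟩ := h2a
  exact SplitBlockCoreK.PassesSheaf.hasHyperbolicBFSheafSeedOn δ hE hψ hδ

def Rung2bSheafK (C : ChernCharacterBetti) (I : Finset ℕ) (σ : DepthBoundA4.Design → ℤ) (π : ℤ) : Prop :=
  ∀ (E₀ : AbelianVariety ℂ) (ψ₀ : E₀ ⟶ E₀), E₀.dim = 1 → ψ₀ ≫ ψ₀ = -(1 • 𝟙 E₀) →
    ∀ δ : SplitBlockCoreK C E₀ ψ₀, δ.PassesSheaf I → ShadowRows σ π δ.Dsh.shadow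

theorem not_rung2aSheafK_of_rung2bSheafK_of_sPlus {I : Finset ℕ} {h : ℤ} {σ : DepthBoundA4.Design → ℤ} {π : ℤ}
    (h2b : Rung2bSheafK C I σ π) (hS : RuleDPlate.SPlus h σ π) : ¬ Rung2aSheafK C I h := by
  rintro ⟨E₀, ψ₀, hE, hψ, δ, hδ, hscope⟩
  exact SieveRows.false_of_sPlus ⟨hscope, h2b E₀ ψ₀ hE hψ δ hδ⟩ hS

end Rungs

/-! ### The Porteous reading (`π = 672`): `Z = D₄(𝒪⁵ → 𝓔)`, the sibling datum over v5's `TwoTermDatum` -/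

section Porteous

variable {E₀ : AbelianVariety ℂ} {ψ₀ : E₀ ⟶ E₀} {C : ChernCharacterBetti}

/-- **THE SPLIT-BLOCK DATUM, DEGENERACY READING**: the shell design's block with split terms as before, a rank-`4` CLASS design `D` (C0 is read
on it), a clean design `D'` with `μ(D') = μ(D)` and a two-term datum `ρ = (𝓟', 𝓝', φ)` of ranks `(a, a + 3)` realising it whose `𝓝'` IS the block's
cokernel `𝓔` (`a + 3 = rank 𝓔`; intended `𝓟' = 𝒪⁵`, `a = 5`, `rank 𝓔 = 8`), and the presented subscheme = the degeneracy scheme of `φ`. -/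
structure SplitBlockDatumP (C : ChernCharacterBetti) (E₀ : AbelianVariety ℂ) (ψ₀ : E₀ ⟶ E₀) extends SplitBlockCore C E₀ ψ₀ where
  /-- the rank-`4` class design (C0) and the rank-`3` virtual design of the two-term datum -/
  D : Design
  D' : Design
  clean' : D'.Clean
  mu_eq : D'.mu = D.mu
  a : ℕ
  ρ : TwoTermDatum C Φ D' a
  /-- the two-term datum's `𝓝'` is the block's cokernel -/
  mid : S.X₃ ≅ ρ.𝓝
  Z : Scheme.{0}
  i : Z ⟶ (pad4Anchor E₀).X.left

namespace SplitBlockDatumP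

variable (δ : SplitBlockDatumP C E₀ ψ₀)

/-- passes (law-free): C-free seed check of `D` ∧ `i` is the degeneracy scheme of `φ`. -/
def Passes : Prop := (∃ q : ℚ, δ.D.SeedCheck δ.K δ.i q) ∧ IsDegeneracySchemeOf δ.ρ.φ δ.i

/-- passes (law-carrying): C0 ∧ degeneracy scheme ∧ C5 ∧ C6-integral ∧ C7. -/
def PassesLaw : Prop :=
  δ.D.ClassData ∧ IsDegeneracySchemeOf δ.ρ.φ δ.i ∧ IsRegularImmersionOfCodim δ.i 4 ∧ AlgebraicGeometry.IsIntegral δ.Z ∧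
    IsBlochSemiregular δ.i (2 * 4) 4

/-- GIVEN THE THOM–PORTEOUS LAW, `PassesLaw ⟹ Passes` (v5 `Design.seedCheck_of_twoTermDegeneracy`). -/
theorem passes_of_passesLaw (hE : E₀.dim = 1) (hψ : ψ₀ ≫ ψ₀ = -(1 • 𝟙 E₀)) (hlaw : PorteousFourLocalisation C) (h : δ.PassesLaw) :
    δ.Passes := by
  obtain ⟨hC0, hZ, hreg, hint, hsr⟩ := h
  obtain ⟨q, hq⟩ := δ.D.seedCheck_of_twoTermDegeneracy hE hψ hC0 ⟨δ.K, δ.Φ, δ.links⟩ δ.clean' δ.mu_eq δ.ρ hlaw hZ hreg hint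
    (codimOfRegularImmersion δ.i 4 hreg) hsr
  exact ⟨⟨q, hq⟩, hZ⟩

/-- a passing datum gives the crux BY NAME on a CM anchor. -/
theorem Passes.blochSeedDiscOne (hE : E₀.dim = 1) (hψ : ψ₀ ≫ ψ₀ = -(1 • 𝟙 E₀)) (h : δ.Passes) :
    Summit.HodgeConjecture.HodgeConjecture.Theses.EightfoldBlochSeeds.BlochSeedDiscOne := by
  obtain ⟨⟨q, hq⟩, _⟩ := h
  exact blochSeedDiscOne_of_coreCert hE hψ ⟨δ.D, δ.K, δ.Z, δ.i, q, hq⟩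

end SplitBlockDatumP

/-- RUNG 2a in the Porteous reading, and its door. -/
def Rung2aP (C : ChernCharacterBetti) (h : ℤ) : Prop :=
  ∃ (E₀ : AbelianVariety ℂ) (ψ₀ : E₀ ⟶ E₀) (_ : E₀.dim = 1) (_ : ψ₀ ≫ ψ₀ = -(1 • 𝟙 E₀)) (δ : SplitBlockDatumP C E₀ ψ₀),
    δ.Passes ∧ ScopeRows h δ.Dsh.shadow

theorem blochSeedDiscOne_of_rung2aP {h : ℤ} (h2a : Rung2aP C h) :
    Summit.HodgeConjecture.HodgeConjecture.Theses.EightfoldBlochSeeds.BlochSeedDiscOne := by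
  obtain ⟨E₀, ψ₀, hE, hψ, δ, hδ, _⟩ := h2a
  exact SplitBlockDatumP.Passes.blochSeedDiscOne δ hE hψ hδ

/-- RUNG 2b in the Porteous reading and its kill path. -/
def Rung2bP (C : ChernCharacterBetti) (σ : DepthBoundA4.Design → ℤ) (π : ℤ) : Prop :=
  ∀ (E₀ : AbelianVariety ℂ) (ψ₀ : E₀ ⟶ E₀), E₀.dim = 1 → ψ₀ ≫ ψ₀ = -(1 • 𝟙 E₀) →
    ∀ δ : SplitBlockDatumP C E₀ ψ₀, δ.Passes → ShadowRows σ π δ.Dsh.shadow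

theorem not_rung2aP_of_rung2bP_of_sPlus {h : ℤ} {σ : DepthBoundA4.Design → ℤ} {π : ℤ} (h2b : Rung2bP C σ π)
    (hS : RuleDPlate.SPlus h σ π) : ¬ Rung2aP C h := by
  rintro ⟨E₀, ψ₀, hE, hψ, δ, hδ, hscope⟩
  exact SieveRows.false_of_sPlus ⟨hscope, h2b E₀ ψ₀ hE hψ δ hδ⟩ hS

end Porteous

/-! ## §41.6 The letter-Hom vanishing law (a NAMED statement, not asserted): what makes the shadow rows `HallUp` ∕ `HallPlusUp` linear algebra -/

section HomLaw

variable {E₀ : AbelianVariety ℂ}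

/-- **LETTER-HOM VANISHING through `(C, Φ)`** — a `Prop`, consumed only as a hypothesis: for cells `P`, `N` and line bundles `L_P`, `L_N` (rank
`≤ 1`) realising their tensors through the word frame, if `N` is NOT weakly live above `P` in the letter model (`DepthBoundA4.WeakLive` on the
shadows: on some factor the difference letter is DEAD — neither equal, null nor ample) then EVERY morphism `L_P → L_N` is zero.  Pencil: `Hom(L_P,
L_N) = H⁰(S⁴, L_N ⊗ L_P^∨)`, a Künneth product of `H⁰`'s of the factor differences, and `H⁰(E₀², 𝒪(a(u+v) + βe + β̄ē) ⊗ Pic⁰) = 0` for a dead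
difference class.  It is the hypothesis under which the zero pattern of the block matrix `SplitBlockDatum.entry` is governed by `WeakLive`, so that
fibrewise injectivity of the block map (`𝓔` locally free) yields `HallUp` by rank count (König–Hall) and — with positivity of the live differences
(Fulton–Lazarsfeld) — `HallPlusUp · 8` (pen rows α1 ∕ α2 of R19.832 (D3)).  [cite: Fulton1998, Thm. 14.4 and Example 12.1.7]
[cite: FultonLazarsfeld1981] -/
def LetterHomVanishing (C : ChernCharacterBetti) (Φ : WordFrame E₀) : Prop :=
  ∀ (P N : MCell) (LP LN : (pad4Anchor E₀).X.left.Modules), HasRankLE LP 1 → HasRankLE LN 1 →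
    RealisesTensor C Φ LP P.ch → RealisesTensor C Φ LN N.ch → ¬ DepthBoundA4.WeakLive (shadowCell P) (shadowCell N) →
      ∀ f : LP ⟶ LN, f = 0

end HomLaw

/-! ## Audit: nothing is decided here

`SplitBlockDatum`, `SplitBlockDatumP`, `BlockTerm` are structures (data) no one has constructed; `Rung2a`, `Rung2aRows`, `Rung2aLaw`, `Rung2aP`,
`Rung2b`, `Rung2bP`, `CoreCert`, `SieveRows`, `ScopeRows`, `ShadowRows`, `LetterHomVanishing` are `Prop`s stated, not asserted;
`TopChernFourLocalisation`, `PorteousFourLocalisation` enter as hypotheses.  Every theorem is an implication between them or an unfolding.  No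
stub of any skeleton is registered or touched; `Lines/birth.lean` and (future) `Lines/splitblock.lean` are other writers'. -/

end SplitBlock

end Summit.HodgeConjecture.HodgeConjecture.Cruxes.BlochSeedDiscOne.SeedChecker
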